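import Summits.PneNP.PneNP.Theorems.UniformStreamUniformStreamLBStubStreamLoopMachine
import HarnessLib

/-!
# The streaming loop machine, II: single steps, work space, good configurations

Route `UniformStream`, crux `UniformStreamLB` (stmt-PneNP-16045), line `birth`, stub `stub_streamLoop`
(`--supports stmt-PneNP-16045`), continuing `UniformStreamUniformStreamLBStubStreamLoopMachine.lean`
(the streaming loop machine `StreamLoop.streamTM M` of a round machine `M`). This file proves:

* counted runs through a predicate: `rin_single`, `rin_trans` (budgets add), `rin_step_trans`,
  `rin_mono` for the pair "`SpaceLoop.RunsVia` (every configuration of the run satisfies `P`) and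
  `TM2Iter.ReachesIn` (within `m` steps)";
* the exact simulation of the round machine (`stepAux_trS`, `st_embM`: one step of `M` is one step of
  the loop machine on the embedded configuration) and one-step lemmas for every control label
  (`st_cnt_cons`, `st_feed_nil` — the tag word of the phase is pushed —, `st_ret_accept`, …);
* the initial configuration (`initList_streamTM`, `streamSM_init`), the embedded `initList`/`haltList`
  of `M`, good configurations (`gd_conf`, …: work space `≤ W` and the read-only input invariant
  `reverse LEFT ++ IN = x`), and `workSpace_eq_wsp`: `wsp` is the work space of the space machine
  `streamSM` (its read-only input `LEFT`/`IN` is not charged, Arora–Barak 2009, Def. 4.1).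

## References

* S. Arora, B. Barak, *Computational Complexity: A Modern Approach*, CUP 2009, Def. 4.1 (space
  bounded computation, read-only input), §4.1 (space is reused), Thm. 4.2, Def. 5.10 (TISP).
  [AroraBarak2009]
* Mathlib, `Mathlib/Computability/TuringMachine/Computable.lean` (`FinTM2`, `initList`, `haltList`).
-/

set_option linter.dupNamespace false

noncomputable section

namespace Summit.PneNP.PneNP.Theorems.UniformStreamLB.Birth

namespace StreamLoop

open Literature.Computability.Complexity Literature.Computability.Complexity.TM2Comp
  Literature.Computability.Complexity.SpaceLoop Turing StateTransition Function

/-! ### Counted runs through a predicate -/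

section RunsIn

variable {C : Type} {f : C → Option C} {P : C → Prop} {a b c : C} {m m' m₁ m₂ : ℕ}

/-- One step (a run through `P` within `1` step). [folklore] -/
theorem rin_single (e : f a = some b) (ha : P a) (hb : P b) :
    RunsVia f P a b ∧ TM2Iter.ReachesIn f a b 1 :=
  ⟨RunsVia.single e ha hb, TM2Iter.ReachesIn.single e⟩

/-- Concatenation of counted runs through `P` (budgets add). [folklore] -/
theorem rin_trans (h₁ : RunsVia f P a b ∧ TM2Iter.ReachesIn f a b m₁)
    (h₂ : RunsVia f P b c ∧ TM2Iter.ReachesIn f b c m₂) :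
    RunsVia f P a c ∧ TM2Iter.ReachesIn f a c (m₁ + m₂) :=
  ⟨h₁.1.trans h₂.1, h₁.2.trans h₂.2⟩

/-- One step followed by a counted run through `P`. [folklore] -/
theorem rin_step_trans (e : f a = some b) (ha : P a)
    (h₂ : RunsVia f P b c ∧ TM2Iter.ReachesIn f b c m) :
    RunsVia f P a c ∧ TM2Iter.ReachesIn f a c (m + 1) :=
  ⟨RunsVia.step_trans e ha h₂.1, TM2Iter.ReachesIn.step_trans e h₂.2⟩

/-- Weakening the budget of a counted run through `P`. [folklore] -/
theorem rin_mono (h : RunsVia f P a b ∧ TM2Iter.ReachesIn f a b m) (hm : m ≤ m') :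
    RunsVia f P a b ∧ TM2Iter.ReachesIn f a b m' :=
  ⟨h.1, h.2.mono hm⟩

end RunsIn

/-! ### Exact simulation of the round machine -/

section Simulation

variable {K : Type} {G : K → Type} {Λ σ : Type}

/-- One statement of the round machine is simulated exactly by its translation. [folklore] -/
theorem stepAux_trS [DecidableEq K] (q : TM2.Stmt G Λ σ) (v : σ) (S : ∀ k, List (G k)) (p : Ph)
    (i lf : List Bool) :
    TM2.stepAux (trS q) ((v, none, p) : Sta σ) (mkStk S i lf [] []) =
      embM (TM2.stepAux q v S) p i lf := by
  induction q generalizing v S with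
  | push k f q ih =>
    simp only [trS, TM2.stepAux]
    rw [← ih, mkStk_inl, mkStk_update_inl]
  | peek k f q ih => simp only [trS, TM2.stepAux]; exact ih _ _
  | pop k f q ih =>
    simp only [trS, TM2.stepAux]
    rw [← ih, mkStk_inl, mkStk_update_inl]
  | load f q ih => simp only [trS, TM2.stepAux]; exact ih _ _
  | branch f q₁ q₂ ih₁ ih₂ =>
    simp only [trS, TM2.stepAux]
    cases f v
    · exact ih₂ _ _
    · exact ih₁ _ _
  | goto l => rfl
  | halt => rfl

end Simulation

section Bundled

variable (M : FinTM2) (eIn : M.Γ M.k₀ ≃ Bool) (eOut : M.Γ M.k₁ ≃ Bool)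

/-! ### Single steps of the control labels -/

section Steps

variable (v : M.σ) (p : Ph) (S : ∀ k, List (M.Γ k)) (i lf t : List Bool)

/-- `cnt` on a nonempty input stack: the symbol goes to `LEFT`, then `feed`. [folklore] -/
theorem st_cnt_cons (a : Bool) :
    (streamTM M eIn eOut).step (conf M (some (Sum.inr Lbl.cnt)) v p S (a :: i) lf t) =
      some (conf M (some (Sum.inr Lbl.feed)) v p S i (a :: lf) t) := by
  rw [conf, st_inr]; simp [lblStmt, keep, conf]

/-- `cnt` on an empty input stack: go to `rew`. [folklore] -/
theorem st_cnt_nil :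
    (streamTM M eIn eOut).step (conf M (some (Sum.inr Lbl.cnt)) v p S [] lf t) =
      some (conf M (some (Sum.inr Lbl.rew)) v p S [] lf t) := by
  rw [conf, st_inr]; simp [lblStmt, keep, conf]

/-- `feed` on nonempty `TMP`: move one symbol to `k₀` (through `eIn.symm`). [folklore] -/
theorem st_feed_cons (s : Bool) :
    (streamTM M eIn eOut).step (conf M (some (Sum.inr Lbl.feed)) v p S i lf (s :: t)) =
      some (conf M (some (Sum.inr Lbl.feed)) v p (update S M.k₀ (eIn.symm s :: S M.k₀)) i lf t) := by
  rw [conf, st_inr]; simp [lblStmt, keep, conf]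

/-- `feed` on empty `TMP`: push the tag word of the phase on `k₀` and start the round machine.
[folklore] -/
theorem st_feed_nil :
    (streamTM M eIn eOut).step (conf M (some (Sum.inr Lbl.feed)) v p S i lf []) =
      some (conf M (some (Sum.inl M.main)) v p (update S M.k₀ (p.tags.map eIn.symm ++ S M.k₀)) i lf []) := by
  rw [conf, st_inr]
  cases p <;> simp [lblStmt, feedFin, keep, conf, Ph.bit, Ph.tagHi, Ph.tagLo]

/-- `ret` in the accepting round: halt. [folklore] -/
theorem st_ret_accept (stk : ∀ j, List (LoopΓ M.Γ j)) :
    (streamTM M eIn eOut).step (⟨some (Sum.inr Lbl.ret), (v, none, Ph.accept), stk⟩ : Conf M) =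
      some (⟨none, (v, none, Ph.accept), stk⟩ : Conf M) := by
  rw [st_inr]; simp [lblStmt, Ph.isAcc]

/-- `ret` in a non-accepting round: go to `mv`. [folklore] -/
theorem st_ret_of_ne (hp : p ≠ Ph.accept) :
    (streamTM M eIn eOut).step (conf M (some (Sum.inr Lbl.ret)) v p S i lf t) =
      some (conf M (some (Sum.inr Lbl.mv)) v p S i lf t) := by
  rw [conf, st_inr]; cases p <;> simp_all [lblStmt, Ph.isAcc, conf]

/-- `mv` on nonempty `k₁`: move one symbol to `TMP` (through `eOut`). [folklore] -/
theorem st_mv_cons (g : M.Γ M.k₁) (L : List (M.Γ M.k₁)) :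
    (streamTM M eIn eOut).step (conf M (some (Sum.inr Lbl.mv)) v p (update S M.k₁ (g :: L)) i lf t) =
      some (conf M (some (Sum.inr Lbl.mv)) v p (update S M.k₁ L) i lf (eOut g :: t)) := by
  rw [conf, st_inr]; simp [lblStmt, keep, conf]

/-- `mv` on empty `k₁`: continue with the label `p.next`. [folklore] -/
theorem st_mv_nil :
    (streamTM M eIn eOut).step (conf M (some (Sum.inr Lbl.mv)) v p (update S M.k₁ []) i lf t) =
      some (conf M (some (Sum.inr p.next)) v p (update S M.k₁ []) i lf t) := by
  rw [conf, st_inr]; simp [lblStmt, keep, conf]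

/-- `rew` on nonempty `LEFT`: move one symbol back to `IN`. [folklore] -/
theorem st_rew_cons (a : Bool) :
    (streamTM M eIn eOut).step (conf M (some (Sum.inr Lbl.rew)) v p S i (a :: lf) t) =
      some (conf M (some (Sum.inr Lbl.rew)) v p S (a :: i) lf t) := by
  rw [conf, st_inr]; simp [lblStmt, keep, conf]

/-- `rew` on empty `LEFT`: phase `init`, then `feed`. [folklore] -/
theorem st_rew_nil :
    (streamTM M eIn eOut).step (conf M (some (Sum.inr Lbl.rew)) v p S i [] t) =
      some (conf M (some (Sum.inr Lbl.feed)) v Ph.init S i [] t) := by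
  rw [conf, st_inr]; simp [lblStmt, setPh, conf]

/-- `strm` on a nonempty input stack: the bit goes to `LEFT` and into the phase, then `feed`.
[folklore] -/
theorem st_strm_cons (b : Bool) :
    (streamTM M eIn eOut).step (conf M (some (Sum.inr Lbl.strm)) v p S (b :: i) lf t) =
      some (conf M (some (Sum.inr Lbl.feed)) v (Ph.stream b) S i (b :: lf) t) := by
  rw [conf, st_inr]; simp [lblStmt, conf]

/-- `strm` on an empty input stack: phase `accept`, then `feed`. [folklore] -/
theorem st_strm_nil :
    (streamTM M eIn eOut).step (conf M (some (Sum.inr Lbl.strm)) v p S [] lf t) =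
      some (conf M (some (Sum.inr Lbl.feed)) v Ph.accept S [] lf t) := by
  rw [conf, st_inr]; simp [lblStmt, setPh, conf]

/-- A step of the round machine `M` is a step of the streaming loop machine on the embedded
configuration. [folklore] -/
theorem st_embM (a b : M.Cfg) (h : M.step a = some b) (p : Ph) (i lf : List Bool) :
    (streamTM M eIn eOut).step (embM a p i lf) = some (embM b p i lf) := by
  obtain ⟨_ | l, w, S'⟩ := a
  · simp [FinTM2.step, TM2.step] at h
  · simp only [FinTM2.step, TM2.step] at h
    obtain rfl := Option.some.inj h
    simp only [embM, Option.elim]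
    rw [st_inl, stepAux_trS]
    rfl

end Steps

/-- The initial configuration of the streaming loop machine. [folklore] -/
theorem initList_streamTM (l : List Bool) :
    initList (streamTM M eIn eOut) l =
      conf M (some (Sum.inr Lbl.cnt)) M.initialState Ph.count (botStk M) l [] [] := by
  rw [initList_eq]
  change (⟨some (Sum.inr Lbl.cnt), (M.initialState, none, Ph.count),
      update (fun j => ([] : List (LoopΓ M.Γ j))) (Sum.inr Aux.IN) l⟩ : Conf M) = _
  rw [← mkStk_bot_IN]
  rfl

/-- The embedded initial configuration of `M` on input `l`. [folklore] -/
theorem embM_initList (l : List (M.Γ M.k₀)) (p : Ph) (i lf : List Bool) :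
    embM (initList M l) p i lf =
      conf M (some (Sum.inl M.main)) M.initialState p (update (botStk M) M.k₀ l) i lf [] := by
  rw [initList_eq]; rfl

/-- The embedded halting configuration of `M` with output `L`: the machine is at `ret`.
[folklore] -/
theorem embM_haltList (L : List (M.Γ M.k₁)) (p : Ph) (i lf : List Bool) :
    embM (haltList M L) p i lf =
      conf M (some (Sum.inr Lbl.ret)) M.initialState p (update (botStk M) M.k₁ L) i lf [] := by
  rw [haltList_eq]; rfl


/-! ### Good configurations, the initial configuration, the work space -/

section Space

/-- An explicit configuration is good (work space `≤ W`, read-only input invariant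
`reverse LEFT ++ IN = x`). [cite: AroraBarak2009, Def. 4.1 (work tapes; read-only input tape)] -/
theorem gd_mk {W : ℕ} {x : List Bool} {l : Option (M.Λ ⊕ Lbl)} {var : Sta M.σ}
    {S : ∀ k, List (M.Γ k)} {i lf t o : List Bool}
    (h1 : stkLen M S + t.length + o.length ≤ W) (h2 : lf.reverse ++ i = x) :
    wsp M ⟨l, var, mkStk S i lf t o⟩ ≤ W ∧
      ((⟨l, var, mkStk S i lf t o⟩ : Conf M).stk (Sum.inr Aux.LEFT)).reverse ++
        (⟨l, var, mkStk S i lf t o⟩ : Conf M).stk (Sum.inr Aux.IN) = x :=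
  ⟨h1, h2⟩

/-- A `conf` is good. [folklore] -/
theorem gd_conf {W : ℕ} {x : List Bool} {l : Option (M.Λ ⊕ Lbl)} {v : M.σ} {p : Ph}
    {S : ∀ k, List (M.Γ k)} {i lf t : List Bool}
    (h1 : stkLen M S + t.length ≤ W) (h2 : lf.reverse ++ i = x) :
    wsp M (conf M l v p S i lf t) ≤ W ∧
      ((conf M l v p S i lf t).stk (Sum.inr Aux.LEFT)).reverse ++
        (conf M l v p S i lf t).stk (Sum.inr Aux.IN) = x :=
  ⟨by simpa using h1, h2⟩

/-- An embedded configuration of `M` is good. [folklore] -/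
theorem gd_embM {W : ℕ} {x : List Bool} {c : M.Cfg} {p : Ph} {i lf : List Bool}
    (h1 : stkLen M c.stk ≤ W) (h2 : lf.reverse ++ i = x) :
    wsp M (embM c p i lf) ≤ W ∧
      ((embM c p i lf).stk (Sum.inr Aux.LEFT)).reverse ++ (embM c p i lf).stk (Sum.inr Aux.IN) = x :=
  ⟨by simpa using h1, h2⟩

/-- The initial configuration of the space machine. [folklore] -/
theorem streamSM_init (l : List Bool) :
    (streamSM M eIn eOut).init l =
      conf M (some (Sum.inr Lbl.cnt)) M.initialState Ph.count (botStk M) l [] [] := by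
  have h : l.map (streamSM M eIn eOut).inputAlphabet.symm = l := by
    show List.map (⇑(Equiv.refl Bool).symm) l = l
    simp only [Equiv.refl_symm, Equiv.coe_refl, List.map_id]
  rw [SpaceMachine.init, h]
  exact initList_streamTM M eIn eOut l

/-- **The work space of the space machine is `wsp`.** [cite: AroraBarak2009, Def. 4.1] -/
theorem workSpace_eq_wsp (c : Conf M) : (streamSM M eIn eOut).workSpace c = wsp M c := by
  letI := M.kFin
  unfold SpaceMachine.workSpace
  change ∑ k ∈ ((Finset.univ : Finset (M.K ⊕ Aux)).erase (Sum.inr Aux.IN)).erase (Sum.inr Aux.LEFT),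
    (c.stk k).length = _
  rw [workStacks_eq, Finset.sum_union, Finset.sum_image (fun a _ b _ h => Sum.inl_injective h),
    Finset.sum_pair (by simp)]
  · simp only [wsp, stkLen]
    omega
  · rw [Finset.disjoint_left]
    rintro j hj hj'
    simp only [Finset.mem_image, Finset.mem_univ, true_and] at hj
    obtain ⟨k, rfl⟩ := hj
    simp at hj'

end Space

end Bundled

end StreamLoop

/-- **Registered sub-goal `stub_streamLoop_part2` (part 2 of the proof of `stub_streamLoop`): the
work space charged to the space machine `StreamLoop.streamSM` (every stack except the read-only
input `LEFT`/`IN`) is `StreamLoop.wsp`.** [cite: AroraBarak2009, Def. 4.1 (only work tapes are charged)] -/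
theorem stub_streamLoop_part2 :
    ∀ (M : Turing.FinTM2) (eIn : M.Γ M.k₀ ≃ Bool) (eOut : M.Γ M.k₁ ≃ Bool) (c : StreamLoop.Conf M),
      (StreamLoop.streamSM M eIn eOut).workSpace c = StreamLoop.wsp M c :=
  StreamLoop.workSpace_eq_wsp

end Summit.PneNP.PneNP.Theorems.UniformStreamLB.Birth
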